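import Literature.Geometry.Lorentzian.CoordTensorCovariance
import Literature.Geometry.Lorentzian.CoordCurvatureDerivatives
import Literature.Geometry.Lorentzian.CoordPartialDerivBounds
import HarnessLib

/-!
# Bounds on all coordinate derivatives of `Γ`, `g^{-1}` and `Ric` from bounds on `∇^k Rm`
(topic `Geometry/Lorentzian`, coordinate calculus)

The conversion "(5.3.3) ⇒ (5.3.4)" of Topping 2006, proof of Thm. 5.3.1 (p. 47) — from bounds
on the covariant derivatives of the curvature to bounds on the COORDINATE derivatives of the
Ricci components — in the route of Hamilton 1982, §14 / Chow–Knopf 2004, §6.7 (no time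
derivatives of the curvature are used): along a one-parameter family of metric components
`G t` on `V` solving the Ricci flow `∂G/∂t = −2 Ric(G)` on `[t₁, T) × V`, uniformly positive
definite on a compact `K ⊆ V`, with all components of all `∇^k Rm` bounded on `[t₁, T) × K`,
ALL iterated partial derivatives of the Christoffel symbols `Γ^m_{ji}`, of the inverse metric
`g^{ac}` and of the Ricci components `R_{il}` are bounded on `[t₁, T) × K`
(`IsMetricFamilyOn.pdBddOn_chrCoef / _ginv / _ricAt`).

The induction (on the order `n` of differentiation, `pdBddOn_all`): bounds of order `n` on
`g^{-1}` and on the components of the `∇^k Rm` give bounds of order `n` on `Γ` by TIME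
INTEGRATION of `∂_tΓ = −g^{-1} * ∇Ric` (`chrDot_ricciFlow`; `∇Ric = g^{-1} * ∇Rm`,
`tcov_ric2_eq_sum`; `abs_pdIter_le_of_deriv`), and then bounds of order `n + 1` on `g^{-1}`
(`∂g^{-1} = −Γ g^{-1} − g^{-1} Γ`, `fderiv_ginv_eq_chrCoef`) and on the `∇^k Rm`
(`∂_j (∇^kRm)_I = (∇^{k+1}Rm)_{jI} + Σ Γ ⋆ ∇^kRm`, `pd_curvD_eq`); finally
`R_{il} = Σ g^{pq} Rm_{pilq}`.

## References

* P. Topping, *Lectures on the Ricci flow*, LMS Lecture Note Series 325, CUP 2006, proof of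
  Thm. 5.3.1, pp. 47–48 ((5.3.3)–(5.3.4)). [Topping2006]
* R. S. Hamilton, *Three-manifolds with positive Ricci curvature*, J. Differential Geom. 17
  (1982), §14 (Lemma 14.2 ff.). [Hamilton1982]
* B. O'Neill, *Semi-Riemannian geometry*, 1983, Ch. 3, p. 86 (`∂ g^{-1}` through `Γ`). [ONeill1983]
-/

noncomputable section

open Set Filter Module Function
open scoped Topology ContDiff

namespace Literature.Geometry.Lorentzian

namespace MetricCoord

variable {E : Type*} [NormedAddCommGroup E] [NormedSpace ℝ E] {ι : Type*}

/-! ### Pointwise identities: coordinate derivatives through covariant ones -/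

section Identities

variable [Fintype ι] [DecidableEq ι] (b : Basis ι ℝ E) {G : E → E →L[ℝ] E →L[ℝ] ℝ} {V : Set E}
  {x : E} [FiniteDimensional ℝ E] [CompleteSpace E]

omit [DecidableEq ι] [FiniteDimensional ℝ E] [CompleteSpace E] in
/-- **`∂_j T_I = (∇T)_{jI} + Σ_a Σ_m Γ^m_{jI_a} T_{I[a↦m]}`** (the definition of `∇`, solved for
the coordinate derivative). [cite: ONeill1983, Ch. 2, Prop. 2.13] -/
theorem pd_apply_eq_tcov {α : Type*} [Fintype α] [DecidableEq α] (T : E → (α → ι) → ℝ) (x : E)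
    (j : ι) (I : α → ι) :
    pd b j (fun y ↦ T y I) x =
      tcov G b T x (ocons j I) + ∑ a, ∑ m, chrCoef G b x j (I a) m * T x (update I a m) := by
  rw [pd_apply, tcov_apply_ocons]; ring

omit [DecidableEq ι] [FiniteDimensional ℝ E] [CompleteSpace E] in
/-- `(∇ ∇^kRm)_{jI} = (∇^{k+1}Rm)` at the relabelled index. [cite: Topping2006, §3.3] -/
theorem tcov_curvD_eq (Gf : ℝ → E → E →L[ℝ] E →L[ℝ] ℝ) (k : ℕ) (t : ℝ) (x : E) (J : Option (Fin (4 + k)) → ι) :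
    tcov (Gf t) b (curvD Gf b k t) x J = curvD Gf b (k + 1) t x (J ∘ (idxEquiv k).symm) := by
  rw [curvD_succ, treindex_apply, Function.comp_assoc, Equiv.symm_comp_self, Function.comp_id]

omit [DecidableEq ι] [FiniteDimensional ℝ E] [CompleteSpace E] in
/-- **`∂_j (∇^kRm)_I = (∇^{k+1}Rm)_{(jI)'} + Σ_a Σ_m Γ^m_{jI_a} (∇^kRm)_{I[a↦m]}`.**
[cite: Topping2006, §5.3, p. 47] -/
theorem pd_curvD_eq (Gf : ℝ → E → E →L[ℝ] E →L[ℝ] ℝ) (k : ℕ) (t : ℝ) (x : E) (j : ι) (I : Fin (4 + k) → ι) :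
    pd b j (fun y ↦ curvD Gf b k t y I) x =
      curvD Gf b (k + 1) t x (ocons j I ∘ (idxEquiv k).symm)
        + ∑ a, ∑ m, chrCoef (Gf t) b x j (I a) m * curvD Gf b k t x (update I a m) := by
  rw [pd_apply_eq_tcov b (G := Gf t), tcov_curvD_eq]

omit [DecidableEq ι] in
/-- **`∇Ric = g^{-1} * ∇Rm` in components**:
`(∇Ric)_{j;il} = Σ_{pq} g^{pq} (∇Rm)_{(j p i l q)'}` on the domain of the metric (the Ricci
tensor is the trace of `Rm`, `ric2_eq_ttr`, and `∇` commutes with the metric trace,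
`tcov_ttr`). [cite: ONeill1983, Ch. 3, Lemma 3.52] -/
theorem IsMetricOn.tcov_ric2_eq_sum (Gf : ℝ → E → E →L[ℝ] E →L[ℝ] ℝ) {t : ℝ} (hG : IsMetricOn (Gf t) V)
    (hx : x ∈ V) (j i l : ι) :
    tcov (Gf t) b (ric2 (Gf t) b) x (ocons j ![i, l]) =
      ∑ p, ∑ q, ginv (Gf t) b x p q *
        curvD Gf b 1 t x ((ocons j (ocons p (ocons q ![i, l])) ∘ ricTraceEquiv.optionCongr) ∘ (idxEquiv 0).symm) := by
  have heq : ∀ y ∈ V, ∀ J, ric2 (Gf t) b y J = ttr (Gf t) b (treindex ricTraceEquiv (rm4 (Gf t) b)) y J :=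
    fun y hy J ↦ ric2_eq_ttr b (hG.isInvertible y hy) J
  rw [tcov_congr_of_eqOn hG.isOpen (fun _ _ ↦ rfl) heq hx,
    hG.tcov_ttr ((hG.tsmoothOn_rm4 b).treindex _) hx]
  refine Finset.sum_congr rfl fun p _ ↦ Finset.sum_congr rfl fun q _ ↦ ?_
  rw [tcov_treindex, treindex_apply, ← curvD_zero, tcov_curvD_eq]

omit [DecidableEq ι] [CompleteSpace E] in
/-- **`R_{il} = Σ_{pq} g^{pq} Rm_{pilq}`** at points where the metric is invertible.
[cite: ONeill1983, Ch. 3, Lemma 3.52] -/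
theorem ricAt_basis_eq_sum_curvD (Gf : ℝ → E → E →L[ℝ] E →L[ℝ] ℝ) (t : ℝ) (hx : (Gf t x).IsInvertible)
    (i l : ι) :
    ricAt (Gf t) x (b i) (b l) = ∑ p, ∑ q, ginv (Gf t) b x p q * curvD Gf b 0 t x ![p, i, l, q] := by
  rw [ricAt_eq_sum_ginv b hx]
  rfl

end Identities

/-! ### The families and their smoothness -/

section Families

variable [Fintype ι] [DecidableEq ι] (G : ℝ → E → E →L[ℝ] E →L[ℝ] ℝ) (b : Basis ι ℝ E)
  [FiniteDimensional ℝ E]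

/-- The Christoffel symbols of the family as time-dependent scalar fields. [folklore] -/
def gammaFam (j i m : ι) : ℝ → E → ℝ := fun t y ↦ chrCoef (G t) b y j i m

/-- The inverse metric of the family as time-dependent scalar fields. [folklore] -/
def ginvFam (a c : ι) : ℝ → E → ℝ := fun t y ↦ ginv (G t) b y a c

/-- The components of `∇^k Rm` of the family as time-dependent scalar fields. [folklore] -/
def curvDFam (k : ℕ) (I : Fin (4 + k) → ι) : ℝ → E → ℝ := fun t y ↦ curvD G b k t y I

variable {G b}

omit [Fintype ι] [DecidableEq ι] [FiniteDimensional ℝ E] in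
/-- Unfolding lemma. [folklore] -/
@[simp] theorem gammaFam_apply (j i m : ι) (t : ℝ) (y : E) : gammaFam G b j i m t y = chrCoef (G t) b y j i m := rfl

omit [Fintype ι] [DecidableEq ι] in
/-- Unfolding lemma. [folklore] -/
@[simp] theorem ginvFam_apply (a c : ι) (t : ℝ) (y : E) : ginvFam G b a c t y = ginv (G t) b y a c := rfl

omit [DecidableEq ι] [FiniteDimensional ℝ E] in
/-- Unfolding lemma. [folklore] -/
@[simp] theorem curvDFam_apply (k : ℕ) (I : Fin (4 + k) → ι) (t : ℝ) (y : E) :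
    curvDFam G b k I t y = curvD G b k t y I := rfl

end Families

/-! ### The induction -/

namespace IsMetricFamilyOn

section Bounds

variable [Fintype ι] {G : ℝ → E → E →L[ℝ] E →L[ℝ] ℝ} {V K : Set E} {t₁ T : ℝ}
  (b : Basis ι ℝ E) [FiniteDimensional ℝ E] [CompleteSpace E]
  (hG : IsMetricFamilyOn G (Ico t₁ T) V)
  (hfl : ∀ s ∈ Ico t₁ T, ∀ y ∈ V, tDeriv G (Ico t₁ T) s y = (-2 : ℝ) • ricAt (G s) y)
  (hK : IsCompact K) (hKV : K ⊆ V) (ht₁ : t₁ < T)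
include hG

omit [Fintype ι] in
/-- Smooth slices of `Γ`. [folklore] -/
theorem smoothSlicesOn_gammaFam (j i m : ι) : SmoothSlicesOn V (Ico t₁ T) (gammaFam G b j i m) :=
  fun t ht ↦ (hG.isMetricOn t ht).contDiffOn_chrCoef b j i m

/-- Smooth slices of `g^{-1}`. [folklore] -/
theorem smoothSlicesOn_ginvFam (a c : ι) : SmoothSlicesOn V (Ico t₁ T) (ginvFam G b a c) :=
  fun t ht ↦ (hG.isMetricOn t ht).contDiffOn_ginv b a c

/-- Smooth slices of the `∇^k Rm`. [folklore] -/
theorem smoothSlicesOn_curvDFam (k : ℕ) (I : Fin (4 + k) → ι) :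
    SmoothSlicesOn V (Ico t₁ T) (curvDFam G b k I) :=
  fun t ht ↦ (hG.isMetricOn t ht).tsmoothOn_curvD k I

include hKV ht₁ in
/-- **Order `n` on `Γ` and `g^{-1}` gives order `n + 1` on `g^{-1}`** (`∂g^{-1} = −g^{-1}Γ − Γg^{-1}`).
[cite: ONeill1983, Ch. 3, p. 86] -/
theorem pdBddOn_ginvFam_succ {n : ℕ} (hΓ : ∀ j i m, PDBddOn b (Ico t₁ T) K n (gammaFam G b j i m))
    (hGI : ∀ a c, PDBddOn b (Ico t₁ T) K n (ginvFam G b a c)) (a c : ι) :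
    PDBddOn b (Ico t₁ T) K (n + 1) (ginvFam G b a c) := by
  have hV := hG.isOpen (t := t₁) ⟨le_rfl, ht₁⟩
  intro L hL
  cases L with
  | nil => exact hGI a c [] (by simp)
  | cons j L =>
    have hL' : L.length ≤ n := by simpa using hL
    set Y : ℝ → E → ℝ := fun t y ↦ -(∑ e, ginvFam G b a e t y * gammaFam G b j e c t y)
      - ∑ d, gammaFam G b j d a t y * ginvFam G b d c t y with hY
    have hS1 : SmoothSlicesOn V (Ico t₁ T) (fun t y ↦ ∑ e, ginvFam G b a e t y * gammaFam G b j e c t y) :=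
      SmoothSlicesOn.sum _ fun e _ ↦ (hG.smoothSlicesOn_ginvFam b a e).mul (hG.smoothSlicesOn_gammaFam b j e c)
    have hS2 : SmoothSlicesOn V (Ico t₁ T) (fun t y ↦ ∑ d, gammaFam G b j d a t y * ginvFam G b d c t y) :=
      SmoothSlicesOn.sum _ fun d _ ↦ (hG.smoothSlicesOn_gammaFam b j d a).mul (hG.smoothSlicesOn_ginvFam b d c)
    have hB1 : PDBddOn b (Ico t₁ T) K n (fun t y ↦ ∑ e, ginvFam G b a e t y * gammaFam G b j e c t y) :=
      PDBddOn.sum_mul hV hKV _ (fun e _ ↦ hG.smoothSlicesOn_ginvFam b a e)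
        (fun e _ ↦ hG.smoothSlicesOn_gammaFam b j e c) (fun e _ ↦ hGI a e) fun e _ ↦ hΓ j e c
    have hB2 : PDBddOn b (Ico t₁ T) K n (fun t y ↦ ∑ d, gammaFam G b j d a t y * ginvFam G b d c t y) :=
      PDBddOn.sum_mul hV hKV _ (fun d _ ↦ hG.smoothSlicesOn_gammaFam b j d a)
        (fun d _ ↦ hG.smoothSlicesOn_ginvFam b d c) (fun d _ ↦ hΓ j d a) fun d _ ↦ hGI d c
    have hYb : PDBddOn b (Ico t₁ T) K n Y :=
      (hB1.neg hV hKV hS1).sub hV hKV (fun t ht ↦ (hS1 t ht).neg) hS2 hB2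
    obtain ⟨C, hC⟩ := hYb L hL'
    refine ⟨C, fun t ht y hy ↦ ?_⟩
    have heq : EqOn (pd b j (ginvFam G b a c t)) (Y t) V := fun z hz ↦ by
      simp only [hY, gammaFam_apply]
      exact (hG.isMetricOn t ht).fderiv_ginv_eq_chrCoef b hz a c j
    rw [pdIter_cons, pdIter_congr hV L heq (hKV hy)]
    exact hC t ht y hy

include hKV ht₁ in
/-- **Order `n` on `Γ` and on all `∇^k Rm` gives order `n + 1` on all `∇^k Rm`**
(`∂_j (∇^kRm)_I = (∇^{k+1}Rm)_{jI} + Σ Γ ⋆ ∇^kRm`). [cite: Topping2006, §5.3, p. 47] -/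
theorem pdBddOn_curvDFam_succ {n : ℕ} (hΓ : ∀ j i m, PDBddOn b (Ico t₁ T) K n (gammaFam G b j i m))
    (hD : ∀ k I, PDBddOn b (Ico t₁ T) K n (curvDFam G b k I)) (k : ℕ) (I : Fin (4 + k) → ι) :
    PDBddOn b (Ico t₁ T) K (n + 1) (curvDFam G b k I) := by
  have hV := hG.isOpen (t := t₁) ⟨le_rfl, ht₁⟩
  intro L hL
  cases L with
  | nil => exact hD k I [] (by simp)
  | cons j L =>
    have hL' : L.length ≤ n := by simpa using hL
    set Y : ℝ → E → ℝ := fun t y ↦ curvDFam G b (k + 1) (ocons j I ∘ (idxEquiv k).symm) t y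
      + ∑ a, ∑ m, gammaFam G b j (I a) m t y * curvDFam G b k (update I a m) t y with hY
    have hYb : PDBddOn b (Ico t₁ T) K n Y := by
      refine PDBddOn.add hV hKV (hG.smoothSlicesOn_curvDFam b _ _) ?_ (hD _ _) ?_
      · exact SmoothSlicesOn.sum _ fun a _ ↦ SmoothSlicesOn.sum _ fun m _ ↦
          (hG.smoothSlicesOn_gammaFam b j (I a) m).mul (hG.smoothSlicesOn_curvDFam b k _)
      · exact PDBddOn.sum hV hKV _ (fun a _ ↦ SmoothSlicesOn.sum _ fun m _ ↦
          (hG.smoothSlicesOn_gammaFam b j (I a) m).mul (hG.smoothSlicesOn_curvDFam b k _)) fun a _ ↦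
          PDBddOn.sum_mul hV hKV _ (fun m _ ↦ hG.smoothSlicesOn_gammaFam b j (I a) m)
            (fun m _ ↦ hG.smoothSlicesOn_curvDFam b k _) (fun m _ ↦ hΓ j (I a) m) fun m _ ↦ hD k _
    obtain ⟨C, hC⟩ := hYb L hL'
    refine ⟨C, fun t ht y hy ↦ ?_⟩
    have heq : EqOn (pd b j (curvDFam G b k I t)) (Y t) V := fun z _ ↦ by
      simp only [hY, curvDFam_apply, gammaFam_apply]
      exact pd_curvD_eq b G k t z j I
    rw [pdIter_cons, pdIter_congr hV L heq (hKV hy)]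
    exact hC t ht y hy

include hfl hK hKV ht₁ in
/-- **Order `n` on `g^{-1}` and on all `∇^k Rm` gives order `n` on `Γ`, by time integration**
(`∂_tΓ = −g^{-1} ⋆ ∇Ric = −g^{-1} ⋆ g^{-1} ⋆ ∇Rm` is bounded with its partial derivatives of
order `≤ n`, `∂_t` commutes with `∂^L`, and `∂^L Γ(t₁)` is bounded on the compact `K`).
[cite: Topping2006, §5.3, pp. 47–48] -/
theorem pdBddOn_gammaFam_of {n : ℕ} (hGI : ∀ a c, PDBddOn b (Ico t₁ T) K n (ginvFam G b a c))
    (hD : ∀ k I, PDBddOn b (Ico t₁ T) K n (curvDFam G b k I)) (j i m : ι) :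
    PDBddOn b (Ico t₁ T) K n (gammaFam G b j i m) := by
  have hV := hG.isOpen (t := t₁) ⟨le_rfl, ht₁⟩
  have ht₁m : t₁ ∈ Ico t₁ T := ⟨le_rfl, ht₁⟩
  have hS : UniqueDiffOn ℝ (Ico t₁ T) := uniqueDiffOn_Ico t₁ T
  have hS' : Ico t₁ T ⊆ closure (interior (Ico t₁ T)) := by
    rw [interior_Ico, closure_Ioo ht₁.ne]; exact Ico_subset_Icc_self
  -- the index map of `∇Ric = g^{-1} ⋆ ∇Rm`
  set κ : ι → ι → ι → ι → ι → Fin (4 + 1) → ι := fun j p q i l ↦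
    ((ocons j (ocons p (ocons q ![i, l])) ∘ ricTraceEquiv.optionCongr) ∘ (idxEquiv 0).symm) with hκ
  -- `Tc j i l = (∇Ric)_{j;il}`
  set Tc : ι → ι → ι → ℝ → E → ℝ := fun j i l t y ↦
    ∑ p, ∑ q, ginvFam G b p q t y * curvDFam G b 1 (κ j p q i l) t y with hTc
  have hTcs : ∀ j i l, SmoothSlicesOn V (Ico t₁ T) (Tc j i l) := fun j i l ↦
    SmoothSlicesOn.sum _ fun p _ ↦ SmoothSlicesOn.sum _ fun q _ ↦
      (hG.smoothSlicesOn_ginvFam b p q).mul (hG.smoothSlicesOn_curvDFam b 1 _)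
  have hTcb : ∀ j i l, PDBddOn b (Ico t₁ T) K n (Tc j i l) := fun j i l ↦
    PDBddOn.sum hV hKV _ (fun p _ ↦ SmoothSlicesOn.sum _ fun q _ ↦
      (hG.smoothSlicesOn_ginvFam b p q).mul (hG.smoothSlicesOn_curvDFam b 1 _)) fun p _ ↦
      PDBddOn.sum_mul hV hKV _ (fun q _ ↦ hG.smoothSlicesOn_ginvFam b p q)
        (fun q _ ↦ hG.smoothSlicesOn_curvDFam b 1 _) (fun q _ ↦ hGI p q) fun q _ ↦ hD 1 _
  -- `X = ∂_t Γ^m_{ji}`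
  set X : ℝ → E → ℝ := fun t y ↦ ∑ l, ginvFam G b m l t y *
    (-(Tc j i l t y + Tc i j l t y - Tc l j i t y)) with hX
  have hWs : ∀ l, SmoothSlicesOn V (Ico t₁ T) (fun t y ↦ -(Tc j i l t y + Tc i j l t y - Tc l j i t y)) :=
    fun l t ht ↦ (((hTcs j i l t ht).add (hTcs i j l t ht)).sub (hTcs l j i t ht)).neg
  have hWb : ∀ l, PDBddOn b (Ico t₁ T) K n (fun t y ↦ -(Tc j i l t y + Tc i j l t y - Tc l j i t y)) :=
    fun l ↦ PDBddOn.neg hV hKV (fun t ht ↦ ((hTcs j i l t ht).add (hTcs i j l t ht)).sub (hTcs l j i t ht))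
      (PDBddOn.sub hV hKV (fun t ht ↦ (hTcs j i l t ht).add (hTcs i j l t ht)) (hTcs l j i)
        (PDBddOn.add hV hKV (hTcs j i l) (hTcs i j l) (hTcb j i l) (hTcb i j l)) (hTcb l j i))
  have hXb : PDBddOn b (Ico t₁ T) K n X :=
    PDBddOn.sum_mul hV hKV _ (fun l _ ↦ hG.smoothSlicesOn_ginvFam b m l) (fun l _ ↦ hWs l)
      (fun l _ ↦ hGI m l) fun l _ ↦ hWb l
  -- `∂_t Γ = X` on `V`
  have hderiv : ∀ t ∈ Ico t₁ T, EqOn (fun z ↦ derivWithin (fun s ↦ gammaFam G b j i m s z) (Ico t₁ T) t)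
      (X t) V := by
    intro t ht z hz
    have hGt := hG.isMetricOn t ht
    have h1 := (hG.hasDerivWithinAt_chrCoef b hz ht j i m).derivWithin (hS t ht)
    simp only [gammaFam_apply]
    rw [h1, hG.chrDot_ricciFlow b hfl hz ht j i m, ← Finset.sum_neg_distrib]
    refine Finset.sum_congr rfl fun l _ ↦ ?_
    simp only [hTc, ginvFam_apply, curvDFam_apply, hκ]
    rw [hGt.tcov_ric2_eq_sum b G hz, hGt.tcov_ric2_eq_sum b G hz, hGt.tcov_ric2_eq_sum b G hz]
    ring
  -- joint smoothness of `Γ`, bound at `t₁`, bound for the time derivative of `∂^L Γ`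
  have hjoint : ContDiffOn ℝ ∞ (fun p : E × ℝ ↦ gammaFam G b j i m p.2 p.1) (V ×ˢ Ico t₁ T) :=
    hG.contDiffOn_chrCoef_family b j i m
  intro L hL
  obtain ⟨C, hC⟩ := hXb L hL
  obtain ⟨C₀, hC₀⟩ := hK.exists_bound_of_continuousOn
    ((((hG.smoothSlicesOn_gammaFam b j i m) t₁ ht₁m).pdIter hV L).continuousOn.mono hKV)
  refine ⟨C₀ + C * (T - t₁), abs_pdIter_le_of_deriv hV hKV hjoint L (fun y hy ↦ ?_) fun s hs y hy ↦ ?_⟩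
  · have h := hC₀ y hy
    rwa [Real.norm_eq_abs] at h
  · rw [derivWithin_pdIter_comm hV hS hS' L hjoint (hKV hy) hs, pdIter_congr hV L (hderiv s hs) (hKV hy)]
    exact hC s hs y hy

end Bounds

/-! ### Order zero and the conclusion -/

section Conclusion

variable [Fintype ι] {G : ℝ → E → E →L[ℝ] E →L[ℝ] ℝ} {V K : Set E} {t₁ T : ℝ}
  (b : Basis ι ℝ E) [FiniteDimensional ℝ E] [CompleteSpace E]
  (hG : IsMetricFamilyOn G (Ico t₁ T) V)
  (hfl : ∀ s ∈ Ico t₁ T, ∀ y ∈ V, tDeriv G (Ico t₁ T) s y = (-2 : ℝ) • ricAt (G s) y)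
  (hK : IsCompact K) (hKV : K ⊆ V) (ht₁ : t₁ < T)
  {lam : ℝ} (hlam : 0 < lam) (hpos : ∀ s ∈ Ico t₁ T, ∀ y ∈ K, ∀ v : E, lam * ‖v‖ ^ 2 ≤ G s y v v)
  (hD : ∀ k : ℕ, ∃ C : ℝ, ∀ s ∈ Ico t₁ T, ∀ y ∈ K, ∀ I, |curvD G b k s y I| ≤ C)
include hG

omit [Fintype ι] [CompleteSpace E] in
include hKV hlam hpos in
/-- **`g^{-1}` is bounded on `[t₁, T) × K`** for a family uniformly positive definite there:
`g^{ac} = Σ_c bᵃ(e_c) bᶜ(e_c)` in an orthonormal frame `e`, and `λ ‖e_c‖² ≤ g(e_c, e_c) = 1`.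
[cite: ONeill1983, Ch. 3, p. 60] -/
theorem pdBddOn_ginvFam_zero (a c : ι) : PDBddOn b (Ico t₁ T) K 0 (ginvFam G b a c) := by
  rw [pdBddOn_zero_iff]
  refine ⟨‖coordCLM b a‖ * ‖coordCLM b c‖ * (finrank ℝ E / lam), fun t ht y hy ↦ ?_⟩
  have hGt := hG.isMetricOn t ht
  have hyV := hKV hy
  have hs := hGt.symm y hyV
  have hposy : ∀ v, v ≠ 0 → 0 < G t y v v := fun v hv ↦
    lt_of_lt_of_le (mul_pos hlam (by positivity)) (hpos t ht y hy v)
  obtain ⟨e, he⟩ := exists_orthonormal_basis hs hposy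
  rw [ginvFam_apply, ginv_eq_sum_coord_frame b e he (hGt.isInvertible y hyV) hs]
  have hek : ∀ k, ‖e k‖ ^ 2 ≤ 1 / lam := fun k ↦ by
    rw [le_div_iff₀ hlam, mul_comm]
    have h := hpos t ht y hy (e k)
    rw [he k k, if_pos rfl] at h
    exact h
  calc |∑ k, b.coord a (e k) * b.coord c (e k)| ≤ ∑ k, |b.coord a (e k) * b.coord c (e k)| :=
        Finset.abs_sum_le_sum_abs _ _
    _ ≤ ∑ k : Fin (finrank ℝ E), ‖coordCLM b a‖ * ‖coordCLM b c‖ * (1 / lam) := by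
        refine Finset.sum_le_sum fun k _ ↦ ?_
        rw [abs_mul]
        have h1 : |b.coord a (e k)| ≤ ‖coordCLM b a‖ * ‖e k‖ := by
          rw [← Real.norm_eq_abs, ← coordCLM_apply]; exact (coordCLM b a).le_opNorm _
        have h2 : |b.coord c (e k)| ≤ ‖coordCLM b c‖ * ‖e k‖ := by
          rw [← Real.norm_eq_abs, ← coordCLM_apply]; exact (coordCLM b c).le_opNorm _
        calc |b.coord a (e k)| * |b.coord c (e k)| ≤ (‖coordCLM b a‖ * ‖e k‖) * (‖coordCLM b c‖ * ‖e k‖) :=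
              mul_le_mul h1 h2 (abs_nonneg _) (by positivity)
          _ = ‖coordCLM b a‖ * ‖coordCLM b c‖ * ‖e k‖ ^ 2 := by ring
          _ ≤ _ := mul_le_mul_of_nonneg_left (hek k) (by positivity)
    _ = _ := by rw [Finset.sum_const, Finset.card_univ, Fintype.card_fin, nsmul_eq_mul]; ring

omit [FiniteDimensional ℝ E] [CompleteSpace E] hG in
include hD in
/-- The components of the `∇^k Rm` are bounded (hypothesis, order `0`). [folklore] -/
theorem pdBddOn_curvDFam_zero (k : ℕ) (I : Fin (4 + k) → ι) : PDBddOn b (Ico t₁ T) K 0 (curvDFam G b k I) := by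
  rw [pdBddOn_zero_iff]
  obtain ⟨C, hC⟩ := hD k
  exact ⟨C, fun t ht y hy ↦ hC t ht y hy I⟩

include hfl hK hKV ht₁ hlam hpos hD in
/-- **All iterated partial derivatives of `g^{-1}` and of all `∇^k Rm` are bounded on
`[t₁, T) × K`** (the induction of Hamilton 1982, §14). [cite: Topping2006, §5.3, pp. 47–48]
[cite: Hamilton1982, §14] -/
theorem pdBddOn_all (n : ℕ) :
    (∀ a c, PDBddOn b (Ico t₁ T) K n (ginvFam G b a c)) ∧
      ∀ k I, PDBddOn b (Ico t₁ T) K n (curvDFam G b k I) := by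
  induction n with
  | zero => exact ⟨hG.pdBddOn_ginvFam_zero b hKV hlam hpos, pdBddOn_curvDFam_zero b hD⟩
  | succ n ih =>
    have hΓ := hG.pdBddOn_gammaFam_of b hfl hK hKV ht₁ ih.1 ih.2
    exact ⟨hG.pdBddOn_ginvFam_succ b hKV ht₁ hΓ ih.1, hG.pdBddOn_curvDFam_succ b hKV ht₁ hΓ ih.2⟩

include hfl hK hKV ht₁ hlam hpos hD in
/-- **All iterated partial derivatives of the Christoffel symbols are bounded on `[t₁, T) × K`**
(Topping 2006, p. 47: `|∇^k ∂_i| ≤ C`). [cite: Topping2006, §5.3, p. 47] -/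
theorem pdBddOn_chrCoef (n : ℕ) (j i m : ι) :
    PDBddOn b (Ico t₁ T) K n (fun t y ↦ chrCoef (G t) b y j i m) :=
  hG.pdBddOn_gammaFam_of b hfl hK hKV ht₁ (hG.pdBddOn_all b hfl hK hKV ht₁ hlam hpos hD n).1
    (hG.pdBddOn_all b hfl hK hKV ht₁ hlam hpos hD n).2 j i m

include hfl hK hKV ht₁ hlam hpos hD in
/-- **All iterated partial derivatives of the inverse metric are bounded on `[t₁, T) × K`.**
[cite: Topping2006, §5.3, p. 47] -/
theorem pdBddOn_ginv (n : ℕ) (a c : ι) :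
    PDBddOn b (Ico t₁ T) K n (fun t y ↦ ginv (G t) b y a c) :=
  (hG.pdBddOn_all b hfl hK hKV ht₁ hlam hpos hD n).1 a c

include hfl hK hKV ht₁ hlam hpos hD in
/-- **All iterated partial derivatives of the components of `∇^k Rm` are bounded on
`[t₁, T) × K`.** [cite: Topping2006, §5.3, p. 47] -/
theorem pdBddOn_curvD (n k : ℕ) (I : Fin (4 + k) → ι) :
    PDBddOn b (Ico t₁ T) K n (fun t y ↦ curvD G b k t y I) :=
  (hG.pdBddOn_all b hfl hK hKV ht₁ hlam hpos hD n).2 k I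

include hfl hK hKV ht₁ hlam hpos hD in
/-- **Topping 2006, (5.3.4) with `l = 0`: all iterated partial derivatives of the Ricci components
`R_{il} = Ric(b_i, b_l)` are bounded on `[t₁, T) × K`** (`R_{il} = Σ g^{pq} Rm_{pilq}`).
[cite: Topping2006, §5.3, (5.3.4), p. 47] -/
theorem pdBddOn_ricAt (n : ℕ) (i l : ι) :
    PDBddOn b (Ico t₁ T) K n (fun t y ↦ ricAt (G t) y (b i) (b l)) := by
  have hV := hG.isOpen (t := t₁) ⟨le_rfl, ht₁⟩
  obtain ⟨hGI, hDn⟩ := hG.pdBddOn_all b hfl hK hKV ht₁ hlam hpos hD n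
  have hY : PDBddOn b (Ico t₁ T) K n
      (fun t y ↦ ∑ p, ∑ q, ginvFam G b p q t y * curvDFam G b 0 ![p, i, l, q] t y) :=
    PDBddOn.sum hV hKV _ (fun p _ ↦ SmoothSlicesOn.sum _ fun q _ ↦
      (hG.smoothSlicesOn_ginvFam b p q).mul (hG.smoothSlicesOn_curvDFam b 0 _)) fun p _ ↦
      PDBddOn.sum_mul hV hKV _ (fun q _ ↦ hG.smoothSlicesOn_ginvFam b p q)
        (fun q _ ↦ hG.smoothSlicesOn_curvDFam b 0 _) (fun q _ ↦ hGI p q) fun q _ ↦ hDn 0 _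
  refine hY.congr hV hKV fun t ht y hy ↦ ?_
  simp only [ginvFam_apply, curvDFam_apply]
  exact ricAt_basis_eq_sum_curvD b G t ((hG.isMetricOn t ht).isInvertible y hy) i l

end Conclusion

end IsMetricFamilyOn

end MetricCoord

end Literature.Geometry.Lorentzian

end
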